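import Literature.NumberTheory.LFunctions.TruncatedWeilFormTailMinorsProofs
import Mathlib.Analysis.Calculus.ParametricIntervalIntegral

/-!
# RH-FREE — «nothing here bears on the truth of RH»: the rank-two density representation of the archimedean tail increment (Groskin 2026, arXiv:2607.02828v3, Theorem 3.2, clause (1)) and the discharge `theorem_3_2_holds`

PROOF LAYER (theorems only, no new definitions, no named facts) for the statement file
`Literature/NumberTheory/LFunctions/TruncatedWeilFormTailOrder.lean` ([Gr26], unrefereed; D-0012:
a kernel proof VERIFIES a printed finite statement, it asserts nothing on authority).

## What is proved

[Gr26] Theorem 3.2, clause (1) (p. 10; TeX source `main.tex` ll. 748–799): for `c > 1`,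
`T₂ > T₁ > max(ρN, 7)` and `m, n ∈ I_N`,

  `(Q_arch,T₂ − Q_arch,T₁)(m,n) = (1/π²)∫_{T₁}^{T₂} h₊(T) sin²(LT/2) ρ⁻¹ (p_T(m)p_T(n) + q_T(m)q_T(n)) dT`,

following the printed proof: "since the finite-T archimedean integrand is even in `r`,
`d/dT ψ_arch,T(x) = π⁻² h₊(T) S(T,x,L)`" (here: `ψ_arch,T₂ − ψ_arch,T₁ = π⁻² ∫_{T₁}^{T₂} h₊ S`, by
evenness and additivity of the interval integral); the closed forms at an integer node
`S(T,n,L) = 2 sin²(LT/2) ρ⁻¹ n/(a_T² − n²)` (here in the form `sin²(LT/2)(1/(T−ρn) − 1/(T+ρn))`) and,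
"differentiating under the integral sign and integrating by parts",
`∂ₓS(T,x,L)|_{x=n} = 2 sin²(LT/2) ρ⁻¹ (a_T² + n²)/(a_T² − n²)²`
(here `ρ sin²(LT/2)(1/(T−ρn)² + 1/(T+ρn)²)`);
the diagonal entries of the divided-difference matrix are derivatives of the true source
(`intervalIntegral.hasDerivAt_integral_of_dominated_loc_of_deriv_le`, twice), and the divided
difference of `p`, `q` is `(p(m) − p(n))/(m − n) = p(m)p(n)`, `(q(m) − q(n))/(m − n) = −q(m)q(n)`.
With clause (1) in hand, `theorem_3_2_holds : theorem_3_2` is the glue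
`theorem_3_2_of_repr` of `TruncatedWeilFormTailMinorsProofs` (clause (3) by Andréief + Cauchy,
clause (2) by Sylvester).

LABEL: RH-FREE literature (finite trigonometric calculus at fixed `(c, N)`); bears_on: W-C/W-P
(COLUMN 2 WEIL). WHAT THIS IS NOT: any claim about `ζ`, Weil positivity or RH — "the paper does not
prove RH, Weil positivity, a prime-location bound" ([Gr26] p. 13). Nothing here bears on the truth
of RH.

## References

* [Gr26] A. Groskin, *A finite Guinand–Weil dictionary and archimedean tail order for the truncated
  Weil quadratic form*, arXiv:2607.02828v3 (2026), §3, Theorem 3.2 and its proof.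
-/

noncomputable section

open MeasureTheory Set Filter Finset Matrix Real intervalIntegral
open scoped Real Topology BigOperators Interval

namespace Literature.NumberTheory.LFunctions.Groskin2026

open Literature.Analysis.SpecialFunctions

/-! ## §1. Elementary integrals -/

/-- `∫_a^b sin(β + γy) dy = (cos(β + γa) − cos(β + γb))/γ` (`γ ≠ 0`). [folklore] -/
private theorem integral_sin_linear (β γ a b : ℝ) (hγ : γ ≠ 0) :
    ∫ y in a..b, Real.sin (β + γ * y) = (Real.cos (β + γ * a) - Real.cos (β + γ * b)) / γ := by
  have h := intervalIntegral.integral_comp_mul_add (a := a) (b := b) (f := Real.sin) hγ β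
  simp_rw [add_comm β (γ * _)]
  rw [h, integral_sin, smul_eq_mul]
  field_simp

/-- `∫_a^b (1 − y/L) cos(β + γy) dy` in closed form (`γ ≠ 0`, `L ≠ 0`): the antiderivative is
`(1 − y/L) sin(β + γy)/γ − cos(β + γy)/(Lγ²)`. [folklore] -/
private theorem integral_one_sub_div_mul_cos_linear (β γ L a b : ℝ) (hγ : γ ≠ 0) (hL : L ≠ 0) :
    ∫ y in a..b, (1 - y / L) * Real.cos (β + γ * y) =
      ((1 - b / L) * Real.sin (β + γ * b) / γ - Real.cos (β + γ * b) / (L * γ ^ 2)) -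
        ((1 - a / L) * Real.sin (β + γ * a) / γ - Real.cos (β + γ * a) / (L * γ ^ 2)) := by
  have hderiv : ∀ y ∈ Set.uIcc a b,
      HasDerivAt (fun y => (1 - y / L) * Real.sin (β + γ * y) / γ - Real.cos (β + γ * y) / (L * γ ^ 2))
        ((1 - y / L) * Real.cos (β + γ * y)) y := by
    intro y _
    have h1 : HasDerivAt (fun y => β + γ * y) γ y := by
      simpa using ((hasDerivAt_id y).const_mul γ).const_add β
    have h0 : HasDerivAt (fun y => 1 - y / L) (-(1 / L)) y := by
      simpa using ((hasDerivAt_id y).div_const L).const_sub 1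
    have h2 := ((h0.mul h1.sin).div_const γ).sub (h1.cos.div_const (L * γ ^ 2))
    refine h2.congr_deriv ?_
    field_simp
    ring
  rw [intervalIntegral.integral_eq_sub_of_hasDerivAt hderiv
    ((by fun_prop : Continuous fun y : ℝ => (1 - y / L) * Real.cos (β + γ * y)).intervalIntegrable
      _ _)]

/-- `ρ·L = 2π` (`L = log c`). [cite: Groskin2026, §2.1 (p. 3)] -/
theorem rho_mul_log {c : ℝ} (hc : 1 < c) : rho c * Real.log c = 2 * π := by
  unfold rho
  have hL : Real.log c ≠ 0 := (Real.log_pos hc).ne'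
  field_simp

/-! ## §2. Closed forms of `S(r,n,L)` and `∂ₓS(r,n,L)` at an integer node -/

/-- **`S(r,n,L)` in closed form at an integer node** ([Gr26] Thm 3.2 proof: "direct integration gives
`S(T,n,L) = 2ρn sin²(LT/2)/(T² − ρ²n²)`", here written `sin²(Lr/2)·(1/(r − ρn) − 1/(r + ρn))`), for
`r ≠ ±ρn`. [cite: Groskin2026, Theorem 3.2, proof (p. 10)] -/
theorem archKernelS_intCast_eq {c : ℝ} (hc : 1 < c) (n : ℤ) {r : ℝ}
    (h1 : r - rho c * n ≠ 0) (h2 : r + rho c * n ≠ 0) :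
    archKernelS c r n =
      Real.sin (Real.log c * r / 2) ^ 2 * (1 / (r - rho c * n) - 1 / (r + rho c * n)) := by
  have hL : Real.log c ≠ 0 := (Real.log_pos hc).ne'
  have hρL := rho_mul_log hc
  set L := Real.log c with hLdef
  set ρ := rho c with hρdef
  unfold archKernelS
  rw [← hLdef]
  -- product to sum
  have hpt : ∀ y : ℝ, Real.sin (2 * π * (n : ℝ) * (1 - y / L)) * Real.cos (r * y) =
      (1 / 2) * (Real.sin (2 * π * n + (-(ρ * n + r)) * y) + Real.sin (2 * π * n + (r - ρ * n) * y)) := by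
    intro y
    have e1 : 2 * π * (n : ℝ) * (1 - y / L) = 2 * π * n - ρ * n * y := by
      rw [show ρ = 2 * π / L by rfl]; field_simp
    rw [e1, show 2 * π * (n : ℝ) + -(ρ * n + r) * y = (2 * π * n - ρ * n * y) - r * y by ring,
      show 2 * π * (n : ℝ) + (r - ρ * n) * y = (2 * π * n - ρ * n * y) + r * y by ring,
      ← Real.two_mul_sin_mul_cos]
    ring
  simp_rw [hpt]
  have h2' : -(ρ * n + r) ≠ 0 := by intro h; apply h2; linarith
  rw [intervalIntegral.integral_const_mul,
    intervalIntegral.integral_add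
      ((by fun_prop : Continuous fun y : ℝ =>
        Real.sin (2 * π * n + (-(ρ * n + r)) * y)).intervalIntegrable _ _)
      ((by fun_prop : Continuous fun y : ℝ =>
        Real.sin (2 * π * n + (r - ρ * n) * y)).intervalIntegrable _ _),
    integral_sin_linear _ _ _ _ h2', integral_sin_linear _ _ _ _ h1]
  have hc1 : Real.cos (2 * π * (n : ℝ)) = 1 := by
    rw [show 2 * π * (n : ℝ) = n * (2 * π) by ring]; exact Real.cos_int_mul_two_pi n
  have e2 : 2 * π * (n : ℝ) + -(ρ * n + r) * L = -(r * L) := by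
    linear_combination (-(n : ℝ)) * hρL
  have e3 : 2 * π * (n : ℝ) + (r - ρ * n) * L = r * L := by
    linear_combination (-(n : ℝ)) * hρL
  simp only [mul_zero, add_zero, e2, e3, hc1, Real.cos_neg]
  have hcos : Real.cos (r * L) = 1 - 2 * Real.sin (L * r / 2) ^ 2 := by
    rw [show r * L = 2 * (L * r / 2) by ring, Real.cos_two_mul, Real.cos_sq']; ring
  rw [hcos]
  have h2'' : ρ * n + r ≠ 0 := by intro h; apply h2; linarith
  field_simp
  ring

/-- **`∂ₓS(r,x,L)|_{x=n}` in closed form at an integer node** ([Gr26] Thm 3.2 proof: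
`∂ₓS(T,x,L)|_{x=n} = ∫₀^L 2π(1 − y/L)cos(2πn(1 − y/L))cos(Ty) dy = 2 sin²(LT/2) ρ⁻¹ (a² + n²)/(a² − n²)²`,
here written `ρ sin²(Lr/2)(1/(r − ρn)² + 1/(r + ρn)²)`), for `r ≠ ±ρn`.
[cite: Groskin2026, Theorem 3.2, proof (pp. 10–11)] -/
theorem archKernelS_deriv_intCast_eq {c : ℝ} (hc : 1 < c) (n : ℤ) {r : ℝ}
    (h1 : r - rho c * n ≠ 0) (h2 : r + rho c * n ≠ 0) :
    ∫ y in (0 : ℝ)..Real.log c, 2 * π * (1 - y / Real.log c) *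
        Real.cos (2 * π * (n : ℝ) * (1 - y / Real.log c)) * Real.cos (r * y) =
      rho c * Real.sin (Real.log c * r / 2) ^ 2 *
        (1 / (r - rho c * n) ^ 2 + 1 / (r + rho c * n) ^ 2) := by
  have hL : Real.log c ≠ 0 := (Real.log_pos hc).ne'
  have hρL := rho_mul_log hc
  have hρ : rho c ≠ 0 := (rho_pos hc).ne'
  set L := Real.log c with hLdef
  set ρ := rho c with hρdef
  have hpt : ∀ y : ℝ, 2 * π * (1 - y / L) * Real.cos (2 * π * (n : ℝ) * (1 - y / L)) * Real.cos (r * y) =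
      π * ((1 - y / L) * Real.cos (2 * π * n + (-(ρ * n + r)) * y) +
        (1 - y / L) * Real.cos (2 * π * n + (r - ρ * n) * y)) := by
    intro y
    have e1 : 2 * π * (n : ℝ) * (1 - y / L) = 2 * π * n - ρ * n * y := by
      rw [show ρ = 2 * π / L by rfl]; field_simp
    rw [e1, show 2 * π * (n : ℝ) + -(ρ * n + r) * y = (2 * π * n - ρ * n * y) - r * y by ring,
      show 2 * π * (n : ℝ) + (r - ρ * n) * y = (2 * π * n - ρ * n * y) + r * y by ring,
      ← mul_add, ← Real.two_mul_cos_mul_cos]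
    ring
  simp_rw [hpt]
  have h2' : -(ρ * n + r) ≠ 0 := by intro h; apply h2; linarith
  rw [intervalIntegral.integral_const_mul,
    intervalIntegral.integral_add
      ((by fun_prop : Continuous fun y : ℝ =>
        (1 - y / L) * Real.cos (2 * π * n + (-(ρ * n + r)) * y)).intervalIntegrable _ _)
      ((by fun_prop : Continuous fun y : ℝ =>
        (1 - y / L) * Real.cos (2 * π * n + (r - ρ * n) * y)).intervalIntegrable _ _),
    integral_one_sub_div_mul_cos_linear _ _ _ _ _ h2' hL,
    integral_one_sub_div_mul_cos_linear _ _ _ _ _ h1 hL]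
  have hc1 : Real.cos (2 * π * (n : ℝ)) = 1 := by
    rw [show 2 * π * (n : ℝ) = n * (2 * π) by ring]; exact Real.cos_int_mul_two_pi n
  have hs1 : Real.sin (2 * π * (n : ℝ)) = 0 := by
    rw [show 2 * π * (n : ℝ) = ((2 * n : ℤ) : ℝ) * π by push_cast; ring]
    exact Real.sin_int_mul_pi _
  have e2 : 2 * π * (n : ℝ) + -(ρ * n + r) * L = -(r * L) := by
    linear_combination (-(n : ℝ)) * hρL
  have e3 : 2 * π * (n : ℝ) + (r - ρ * n) * L = r * L := by
    linear_combination (-(n : ℝ)) * hρL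
  simp only [mul_zero, add_zero, e2, e3, hc1, hs1, Real.cos_neg, div_self hL, sub_self,
    zero_mul, zero_div, zero_sub, sub_zero, Real.sin_neg]
  have hcos : Real.cos (r * L) = 1 - 2 * Real.sin (L * r / 2) ^ 2 := by
    rw [show r * L = 2 * (L * r / 2) by ring, Real.cos_two_mul, Real.cos_sq']; ring
  rw [hcos]
  have hπL : π = ρ * L / 2 := by linarith [hρL]
  rw [hπL]
  have h2'' : ρ * n + r ≠ 0 := by intro h; apply h2; linarith
  field_simp
  ring


/-! ## §3. Differentiation under the integral sign -/

/-- The `x`-derivative of `S(r,x,L) = ∫₀^L sin(2πx(1−y/L)) cos(ry) dy` is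
`∫₀^L 2π(1−y/L) cos(2πx(1−y/L)) cos(ry) dy` (differentiation under the integral sign; the
`x`-derivative of the integrand is bounded by `2π|1 − y/L|`).
[cite: Groskin2026, Theorem 3.2, proof (p. 10: "differentiating under the integral sign")] -/
theorem hasDerivAt_archKernelS (c r x₀ : ℝ) :
    HasDerivAt (fun x => archKernelS c r x)
      (∫ y in (0 : ℝ)..Real.log c, 2 * π * (1 - y / Real.log c) *
        Real.cos (2 * π * x₀ * (1 - y / Real.log c)) * Real.cos (r * y)) x₀ := by
  set L := Real.log c with hLdef
  have key := intervalIntegral.hasDerivAt_integral_of_dominated_loc_of_deriv_le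
    (μ := volume) (a := 0) (b := L) (x₀ := x₀) (s := Set.univ)
    (F := fun x y => Real.sin (2 * π * x * (1 - y / L)) * Real.cos (r * y))
    (F' := fun x y => 2 * π * (1 - y / L) * Real.cos (2 * π * x * (1 - y / L)) * Real.cos (r * y))
    (bound := fun y => |2 * π * (1 - y / L)|) Filter.univ_mem
    (Filter.Eventually.of_forall fun x =>
      (by fun_prop : Continuous fun y : ℝ =>
        Real.sin (2 * π * x * (1 - y / L)) * Real.cos (r * y)).aestronglyMeasurable)
    ((by fun_prop : Continuous fun y : ℝ =>
        Real.sin (2 * π * x₀ * (1 - y / L)) * Real.cos (r * y)).intervalIntegrable _ _)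
    ((by fun_prop : Continuous fun y : ℝ => 2 * π * (1 - y / L) *
        Real.cos (2 * π * x₀ * (1 - y / L)) * Real.cos (r * y)).aestronglyMeasurable)
    (ae_of_all _ fun y _ x _ => by
      rw [Real.norm_eq_abs, abs_mul, abs_mul]
      calc |2 * π * (1 - y / L)| * |Real.cos (2 * π * x * (1 - y / L))| * |Real.cos (r * y)|
          ≤ |2 * π * (1 - y / L)| * 1 * 1 := by
            gcongr <;> exact Real.abs_cos_le_one _
        _ = |2 * π * (1 - y / L)| := by ring)
    ((by fun_prop : Continuous fun y : ℝ => |2 * π * (1 - y / L)|).intervalIntegrable _ _)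
    (ae_of_all _ fun y _ x _ => by
      have h1 : HasDerivAt (fun x => 2 * π * x * (1 - y / L)) (2 * π * (1 - y / L)) x := by
        simpa using ((hasDerivAt_id x).const_mul (2 * π)).mul_const (1 - y / L)
      exact (h1.sin.mul_const (Real.cos (r * y))).congr_deriv (by ring))
  exact key.2

/-- Uniform bound `|∂ₓS(r,x,L)| ≤ 2π·L` (`L = log c > 0`) for the `x`-derivative of the kernel
`S(r,x,L)` of [Gr26] eq. (3) — the domination used to differentiate `ψ_{R,T}` under `∫_{−T}^{T}`.
[cite: Groskin2026, §2.1 eq. (3) (p. 3) and Theorem 3.2, proof (p. 10)] -/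
theorem abs_archKernelS_deriv_le {c : ℝ} (hc : 1 < c) (r x : ℝ) :
    |∫ y in (0 : ℝ)..Real.log c, 2 * π * (1 - y / Real.log c) *
        Real.cos (2 * π * x * (1 - y / Real.log c)) * Real.cos (r * y)| ≤
      2 * π * Real.log c := by
  have hL : 0 < Real.log c := Real.log_pos hc
  have h := intervalIntegral.norm_integral_le_of_norm_le_const (a := (0 : ℝ)) (b := Real.log c)
    (C := 2 * π)
    (f := fun y => 2 * π * (1 - y / Real.log c) *
      Real.cos (2 * π * x * (1 - y / Real.log c)) * Real.cos (r * y)) (fun y hy => by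
      rw [Set.uIoc_of_le hL.le] at hy
      rw [Real.norm_eq_abs, abs_mul, abs_mul, abs_mul, abs_of_pos Real.two_pi_pos]
      have h1 : |1 - y / Real.log c| ≤ 1 := by
        rw [abs_le]
        constructor
        · have : y / Real.log c ≤ 1 := by rw [div_le_one hL]; exact hy.2
          linarith
        · have : 0 ≤ y / Real.log c := div_nonneg hy.1.le hL.le
          linarith
      calc 2 * π * |1 - y / Real.log c| * |Real.cos (2 * π * x * (1 - y / Real.log c))| *
            |Real.cos (r * y)| ≤ 2 * π * 1 * 1 * 1 := by
            gcongr <;> exact Real.abs_cos_le_one _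
        _ = 2 * π := by ring)
  rw [Real.norm_eq_abs, sub_zero, abs_of_pos hL] at h
  exact h

/-- Joint continuity helper: `r ↦ ∫₀^L g(y) cos(ry) dy` is continuous for continuous `g`. [folklore] -/
private theorem continuous_integral_mul_cos {g : ℝ → ℝ} (hg : Continuous g) (a b : ℝ) :
    Continuous fun r : ℝ => ∫ y in a..b, g y * Real.cos (r * y) := by
  have h : Continuous (Function.uncurry fun (r y : ℝ) => g y * Real.cos (r * y)) := by
    exact (by fun_prop : Continuous fun p : ℝ × ℝ => g p.2 * Real.cos (p.1 * p.2))
  exact intervalIntegral.continuous_parametric_intervalIntegral_of_continuous' (μ := volume) h a b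

/-- **Derivative of the finite-cutoff archimedean source** `ψ_{R,T}(x) = (1/2π²)∫_{−T}^{T} h₊(r) S(r,x,L) dr`:
`ψ'_{R,T}(x) = (1/2π²)∫_{−T}^{T} h₊(r) ∂ₓS(r,x,L) dr` (differentiation under the integral sign,
dominated by `|h₊(r)|·2πL`, `h₊` continuous). "The diagonal entries of a divided-difference matrix are
derivatives of the true source." [cite: Groskin2026, Theorem 3.2, proof (p. 10–11)] -/
theorem hasDerivAt_archSource {c : ℝ} (hc : 1 < c) (T x₀ : ℝ) :
    HasDerivAt (archSource c T)
      ((1 / (2 * π ^ 2)) * ∫ r in (-T)..T, hPlus r *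
        ∫ y in (0 : ℝ)..Real.log c, 2 * π * (1 - y / Real.log c) *
          Real.cos (2 * π * x₀ * (1 - y / Real.log c)) * Real.cos (r * y)) x₀ := by
  set L := Real.log c with hLdef
  have hcontS : ∀ x : ℝ, Continuous fun r : ℝ => hPlus r * archKernelS c r x := fun x => by
    unfold archKernelS
    exact continuous_hPlus.mul (continuous_integral_mul_cos (by fun_prop) _ _)
  have hcontK : ∀ x : ℝ, Continuous fun r : ℝ => hPlus r *
      ∫ y in (0 : ℝ)..L, 2 * π * (1 - y / L) * Real.cos (2 * π * x * (1 - y / L)) * Real.cos (r * y) :=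
    fun x => continuous_hPlus.mul (continuous_integral_mul_cos (by fun_prop) _ _)
  have key := intervalIntegral.hasDerivAt_integral_of_dominated_loc_of_deriv_le
    (μ := volume) (a := -T) (b := T) (x₀ := x₀) (s := Set.univ)
    (F := fun x r => hPlus r * archKernelS c r x)
    (F' := fun x r => hPlus r *
      ∫ y in (0 : ℝ)..L, 2 * π * (1 - y / L) * Real.cos (2 * π * x * (1 - y / L)) * Real.cos (r * y))
    (bound := fun r => |hPlus r| * (2 * π * L)) Filter.univ_mem
    (Filter.Eventually.of_forall fun x => (hcontS x).aestronglyMeasurable)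
    ((hcontS x₀).intervalIntegrable _ _)
    ((hcontK x₀).aestronglyMeasurable)
    (ae_of_all _ fun r _ x _ => by
      rw [norm_mul, Real.norm_eq_abs, Real.norm_eq_abs]
      exact mul_le_mul_of_nonneg_left (abs_archKernelS_deriv_le hc r x) (abs_nonneg _))
    ((continuous_hPlus.abs.mul continuous_const).intervalIntegrable _ _)
    (ae_of_all _ fun r _ x _ => (hasDerivAt_archKernelS c r x).const_mul (hPlus r))
  have h2 := key.2.const_mul (1 / (2 * π ^ 2))
  exact h2

/-! ## §4. Evenness in `r` and the increment `T₁ → T₂` -/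

/-- For a continuous even `f`, `∫_{−T₂}^{T₂} f − ∫_{−T₁}^{T₁} f = 2∫_{T₁}^{T₂} f`. [folklore] -/
private theorem integral_symm_sub_integral_symm {f : ℝ → ℝ} (hf : Continuous f)
    (heven : ∀ r, f (-r) = f r) (T₁ T₂ : ℝ) :
    (∫ r in (-T₂)..T₂, f r) - ∫ r in (-T₁)..T₁, f r = 2 * ∫ r in T₁..T₂, f r := by
  have h1 := intervalIntegral.integral_add_adjacent_intervals (hf.intervalIntegrable (μ := volume) (-T₂) (-T₁))
    (hf.intervalIntegrable (μ := volume) (-T₁) T₂)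
  have h2 := intervalIntegral.integral_add_adjacent_intervals (hf.intervalIntegrable (μ := volume) (-T₁) T₁)
    (hf.intervalIntegrable (μ := volume) T₁ T₂)
  have h3 : ∫ r in (-T₂)..(-T₁), f r = ∫ r in T₁..T₂, f r := by
    have := intervalIntegral.integral_comp_neg (a := T₁) (b := T₂) f
    simp_rw [heven] at this
    exact this.symm
  linarith

/-- The increment of the archimedean source: `ψ_{R,T₂}(x) − ψ_{R,T₁}(x) = π⁻² ∫_{T₁}^{T₂} h₊(r) S(r,x,L) dr`
("since the finite-`T` archimedean integrand is even in `r`").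
[cite: Groskin2026, Theorem 3.2, proof (p. 10, first display)] -/
theorem archSource_sub_archSource {c : ℝ} (T₁ T₂ x : ℝ) :
    archSource c T₂ x - archSource c T₁ x =
      (1 / π ^ 2) * ∫ r in T₁..T₂, hPlus r * archKernelS c r x := by
  have hcont : Continuous fun r : ℝ => hPlus r * archKernelS c r x := by
    unfold archKernelS
    exact continuous_hPlus.mul (continuous_integral_mul_cos (by fun_prop) _ _)
  have heven : ∀ r : ℝ, hPlus (-r) * archKernelS c (-r) x = hPlus r * archKernelS c r x := by
    intro r
    unfold archKernelS
    simp only [hPlus_neg, neg_mul, Real.cos_neg]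
  unfold archSource
  rw [← mul_sub, integral_symm_sub_integral_symm hcont heven]
  ring

/-- The increment of the derivative of the archimedean source:
`ψ'_{R,T₂}(x) − ψ'_{R,T₁}(x) = π⁻² ∫_{T₁}^{T₂} h₊(r) ∂ₓS(r,x,L) dr`.
[cite: Groskin2026, Theorem 3.2, proof (pp. 10–11)] -/
theorem deriv_archSource_sub_deriv_archSource {c : ℝ} (hc : 1 < c) (T₁ T₂ x : ℝ) :
    deriv (archSource c T₂) x - deriv (archSource c T₁) x =
      (1 / π ^ 2) * ∫ r in T₁..T₂, hPlus r *
        ∫ y in (0 : ℝ)..Real.log c, 2 * π * (1 - y / Real.log c) *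
          Real.cos (2 * π * x * (1 - y / Real.log c)) * Real.cos (r * y) := by
  rw [(hasDerivAt_archSource hc T₂ x).deriv, (hasDerivAt_archSource hc T₁ x).deriv]
  have hcont : Continuous fun r : ℝ => hPlus r *
      ∫ y in (0 : ℝ)..Real.log c, 2 * π * (1 - y / Real.log c) *
        Real.cos (2 * π * x * (1 - y / Real.log c)) * Real.cos (r * y) :=
    continuous_hPlus.mul (continuous_integral_mul_cos (by fun_prop) _ _)
  have heven : ∀ r : ℝ, (hPlus (-r) *
      ∫ y in (0 : ℝ)..Real.log c, 2 * π * (1 - y / Real.log c) *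
        Real.cos (2 * π * x * (1 - y / Real.log c)) * Real.cos (-r * y)) =
      hPlus r * ∫ y in (0 : ℝ)..Real.log c, 2 * π * (1 - y / Real.log c) *
        Real.cos (2 * π * x * (1 - y / Real.log c)) * Real.cos (r * y) := by
    intro r
    simp only [hPlus_neg, neg_mul, Real.cos_neg]
  rw [← mul_sub, integral_symm_sub_integral_symm hcont heven]
  ring


/-! ## §5. Clause (1) of Theorem 3.2 and the discharge -/

/-- **[Gr26] Theorem 3.2, clause (1): the rank-two density representation** of the archimedean tail
increment, entrywise: for `c > 1`, `T₂ > T₁ > max(ρN, 7)` and `m, n ∈ I_N`,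
`(Q_arch,T₂ − Q_arch,T₁)(m,n) = (1/π²)∫_{T₁}^{T₂} h₊(T) sin²(LT/2) ρ⁻¹ (p_T(m)p_T(n) + q_T(m)q_T(n)) dT`
— off the diagonal from the closed form of `S(r,n,L)` and the divided differences
`(p(m) − p(n))/(m − n) = p(m)p(n)`, `(q(m) − q(n))/(m − n) = −q(m)q(n)`; on the diagonal from the
derivative of the true source and the closed form of `∂ₓS(r,n,L)`.
[cite: Groskin2026, Theorem 3.2 (p. 10), clause 1; proof pp. 10–11] -/
theorem archMatrix_sub_apply_eq {c : ℝ} (hc : 1 < c) (N : ℕ) {T₁ T₂ : ℝ}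
    (hT₁ : max (rho c * N) 7 < T₁) (h12 : T₁ < T₂) (m n : idx N) :
    (archMatrix c N T₂ - archMatrix c N T₁) m n =
      (1 / π ^ 2) * ∫ T in T₁..T₂, hPlus T * Real.sin (Real.log c * T / 2) ^ 2 / rho c *
        (pVec c N T m * pVec c N T n + qVec c N T m * qVec c N T n) := by
  have hρ := rho_pos hc
  have hN : rho c * N < T₁ := lt_of_le_of_lt (le_max_left _ _) hT₁
  set ρ := rho c with hρdef
  -- no node is hit on `[T₁, T₂]`
  have hden : ∀ T ∈ Set.uIcc T₁ T₂, ∀ l : idx N,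
      T - ρ * ((l : ℤ) : ℝ) ≠ 0 ∧ T + ρ * ((l : ℤ) : ℝ) ≠ 0 := by
    intro T hT l
    rw [Set.uIcc_of_le h12.le] at hT
    have hl := abs_rho_mul_le hc l
    rw [← hρdef] at hl
    have hl' := abs_lt.1 (lt_of_le_of_lt hl hN)
    constructor
    · intro h; linarith [hT.1, hl'.2]
    · intro h; linarith [hT.1, hl'.1]
  rw [Matrix.sub_apply]
  unfold archMatrix dividedDiffMatrix
  simp only [Matrix.of_apply]
  by_cases hmn : (m : ℤ) = (n : ℤ)
  · -- diagonal entry: derivative of the true source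
    have hmn' : m = n := Subtype.ext hmn
    subst hmn'
    simp only [if_true]
    rw [deriv_archSource_sub_deriv_archSource hc]
    congr 1
    refine intervalIntegral.integral_congr fun T hT ↦ ?_
    obtain ⟨h1, h2⟩ := hden T hT m
    rw [archKernelS_deriv_intCast_eq hc (m : ℤ) h1 h2, pVec_eq hc, qVec_eq hc, ← hρdef]
    field_simp
  · -- off-diagonal entry: divided difference of the closed form of `S`
    simp only [hmn, if_false]
    have hmn' : ((m : ℤ) : ℝ) - ((n : ℤ) : ℝ) ≠ 0 := sub_ne_zero.2 (by exact_mod_cast hmn)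
    rw [← sub_div, show archSource c T₂ ((m : ℤ) : ℝ) - archSource c T₂ ((n : ℤ) : ℝ) -
        (archSource c T₁ ((m : ℤ) : ℝ) - archSource c T₁ ((n : ℤ) : ℝ)) =
        (archSource c T₂ ((m : ℤ) : ℝ) - archSource c T₁ ((m : ℤ) : ℝ)) -
          (archSource c T₂ ((n : ℤ) : ℝ) - archSource c T₁ ((n : ℤ) : ℝ)) by ring,
      archSource_sub_archSource, archSource_sub_archSource, ← mul_sub, mul_div_assoc]
    have hcm : Continuous fun r : ℝ => hPlus r * archKernelS c r ((m : ℤ) : ℝ) := by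
      unfold archKernelS
      exact continuous_hPlus.mul (continuous_integral_mul_cos (by fun_prop) _ _)
    have hcn : Continuous fun r : ℝ => hPlus r * archKernelS c r ((n : ℤ) : ℝ) := by
      unfold archKernelS
      exact continuous_hPlus.mul (continuous_integral_mul_cos (by fun_prop) _ _)
    rw [← intervalIntegral.integral_sub (hcm.intervalIntegrable (μ := volume) _ _)
      (hcn.intervalIntegrable (μ := volume) _ _), ← intervalIntegral.integral_div]
    congr 1
    refine intervalIntegral.integral_congr fun T hT ↦ ?_
    obtain ⟨hm1, hm2⟩ := hden T hT m
    obtain ⟨hn1, hn2⟩ := hden T hT n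
    rw [archKernelS_intCast_eq hc (m : ℤ) hm1 hm2, archKernelS_intCast_eq hc (n : ℤ) hn1 hn2,
      pVec_eq hc, pVec_eq hc, qVec_eq hc, qVec_eq hc, ← hρdef]
    field_simp
    ring

/-- **DISCHARGE of the named fact `theorem_3_2`** ([Gr26] Theorem 3.2 «archimedean tail order», all
three clauses AS TYPED): clause (1) is `archMatrix_sub_apply_eq`; clauses (2)–(3) follow by the glue
`theorem_3_2_of_repr` of `TruncatedWeilFormTailMinorsProofs` (total positivity of the Cauchy–Stieltjes
minors by Andréief's identity and Cauchy's determinant; positive definiteness by Sylvester's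
criterion). RH-FREE; a kernel verification of an unrefereed finite statement (D-0012), asserting
nothing on authority. [cite: Groskin2026, Theorem 3.2 (p. 10)] -/
theorem theorem_3_2_holds : theorem_3_2 :=
  theorem_3_2_of_repr fun _ hc N _ _ hT₁ h12 m n ↦ archMatrix_sub_apply_eq hc N hT₁ h12 m n

end Literature.NumberTheory.LFunctions.Groskin2026

end
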